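import Mathlib
import HarnessLib
import Summits.CriticalPhenomena.PercolationContinuityZ3.Theses.PercTreeValue
import Literature.Probability.Percolation.ClusterBoundary

/-!
# `stub_twoReplica` of line `SketchIdeator2` (crux `TetrahedronDisjointCoexistence`,
# stmt-CriticalPhenomena-7798): the two-replica (cluster-gas) lower bound

Registered stub `stub_twoReplica` (S7) of the lead's skeleton
`Cruxes/TetrahedronDisjointCoexistence/Lines/SketchIdeator2.lean`, landed DEF-FREE over tree
declarations.

Statement: for `P = bondPercolation G p` on any graph with countably many vertices and any `p`,
`(P ⊗ P){(ω₁, ω₂) | a ∈ C₁(o), c ∈ C₂(b), C₂(b) finite, C₁(o) ∩ C₂(b) = ∅} ≤ P(o ↔ a, b ↔ c, o ↮ b)`: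
perforating the graph by an INDEPENDENT copy of the finite cluster of `b` costs the `o–a`
connection no more than disjoint coexistence in ONE configuration.

Proof (explore the finite cluster `C₂(b) = S`, then the Markov property inside one configuration).
* Pointwise cover (`twoReplica_cover`): if `C₂(b) = S` is finite, `c ∈ C₂(b)`, and `C₁(o) ∋ a`
  avoids `S`, then an open `ω₁`-walk from `o` to `a` stays in `C₁(o) ⊆ Sᶜ`, so `ω₁ ∈ {o ↔ a off S}`
  (`twoReplica_mem_offConn_of_disjoint`); hence the event lies in
  `⋃_S {o ↔ a off S} × ({K_b = S} ∩ {b ↔ c})`.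
* `(P ⊗ P)(A × B) ≤ P(A) P(B)` (`Measure.prod_prod_le`) and countable subadditivity over the
  countable index type `Finset V` bound the left-hand side by `Σ'_S P(o ↔ a off S) P(K_b = S, b ↔ c)`.
* On `{K_b = S}`, `b ↔ c` iff `c ∈ S`; for `c ∈ S` the events `{K_b = S}` and `{o ↔ a off S}` are
  independent inside one configuration (disjoint edge supports, `measure_clusterIs_inter_offConn`),
  so each term is at most `P(K_b = S, b ↔ c, o ↔ a off S)` (`twoReplica_prod_piece_le`).
* These events are pairwise disjoint in `S` and measurable, so the sum is the probability of their
  union (`measure_iUnion`), and each lies in `{o ↔ a, b ↔ c, o ↮ b}` because `o ∈ Sᶜ = C(b)ᶜ`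
  (`twoReplica_piece_subset`).
-/

noncomputable section

namespace Summit.CriticalPhenomena.PercolationContinuityZ3.Theorems.TetrahedronDisjointCoexistence

open MeasureTheory
open Literature.Probability.Percolation Literature.Probability.LatticeModels
open scoped ENNReal

variable {V : Type*}

/-- If `a ∈ C_ω(o)` and `C_ω(o)` avoids `T`, then `o ↔ a` off `T`: an open walk from `o` to `a`
has all its vertices in `C_ω(o) ⊆ Tᶜ` (each prefix of the walk witnesses reachability). -/
theorem twoReplica_mem_offConn_of_disjoint {ω : BondConfig V} {o a : V} {T : Set V}
    (ha : a ∈ openCluster ω o) (hdisj : Disjoint (openCluster ω o) T) :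
    ω ∈ openConnIn Tᶜ o a := by
  classical
  obtain ⟨w⟩ := (show (openGraph ω).Reachable o a from ha)
  have hsupp : ∀ v ∈ w.support, v ∈ Tᶜ := by
    intro v hv
    have hv' : v ∈ openCluster ω o := ⟨w.takeUntil v hv⟩
    exact Set.disjoint_left.1 hdisj hv'
  exact DCT16.mem_openConnIn_of_pathIn
    (Literature.Barriers.CriticalPhenomena.pathIn_of_walk_support_subset w hsupp)

/-- On `{K_b = S}`, `b ↔ y` iff `y ∈ S`. -/
theorem twoReplica_mem_openConn_iff {ω : BondConfig V} {b y : V} {S : Finset V}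
    (h : ω ∈ clusterIs b S) : ω ∈ (openConn b y : Set (BondConfig V)) ↔ y ∈ S := by
  rw [mem_clusterIs] at h
  change y ∈ openCluster ω b ↔ y ∈ S
  rw [h, Finset.mem_coe]

/-- **Exploration cover.** The two-replica event is covered by the pieces indexed by the value `S`
of the finite cluster `C₂(b)`:
`{a ∈ C₁(o), c ∈ C₂(b), C₂(b) finite, C₁(o) ∩ C₂(b) = ∅} ⊆ ⋃_S {o ↔ a off S} × ({K_b = S} ∩ {b ↔ c})`. -/
theorem twoReplica_cover (o a b c : V) :
    {q : BondConfig V × BondConfig V | a ∈ openCluster q.1 o ∧ c ∈ openCluster q.2 b ∧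
        (openCluster q.2 b).Finite ∧ Disjoint (openCluster q.1 o) (openCluster q.2 b)} ⊆
      ⋃ S : Finset V, (openConnIn ((↑S : Set V)ᶜ) o a : Set (BondConfig V)) ×ˢ
        (clusterIs b S ∩ openConn b c) := by
  rintro q ⟨ha, hc, hfin, hdisj⟩
  rw [Set.mem_iUnion]
  refine ⟨hfin.toFinset, Set.mem_prod.2 ⟨?_, ?_, hc⟩⟩
  · rw [hfin.coe_toFinset]
    exact twoReplica_mem_offConn_of_disjoint ha hdisj
  · rw [mem_clusterIs, hfin.coe_toFinset]

/-- **Termwise bound inside one configuration.**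
`(P ⊗ P)({o ↔ a off S} × ({K_b = S} ∩ {b ↔ c})) ≤ P({K_b = S} ∩ {b ↔ c} ∩ {o ↔ a off S})`:
for `c ∉ S` the left-hand side vanishes; for `c ∈ S`, `{K_b = S} ∩ {b ↔ c} = {K_b = S}`,
`(P ⊗ P)(A × B) ≤ P(A) P(B)`, and `P(K_b = S) P(o ↔ a off S) = P(K_b = S, o ↔ a off S)` by the
independence of events with disjoint edge supports (`measure_clusterIs_inter_offConn`). -/
theorem twoReplica_prod_piece_le [Countable V] (G : SimpleGraph V) (p : unitInterval)
    (o a b c : V) (S : Finset V) :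
    (bondPercolation G p).prod (bondPercolation G p)
        ((openConnIn ((↑S : Set V)ᶜ) o a : Set (BondConfig V)) ×ˢ (clusterIs b S ∩ openConn b c)) ≤
      bondPercolation G p (clusterIs b S ∩ openConn b c ∩ openConnIn ((↑S : Set V)ᶜ) o a) := by
  by_cases hc : c ∈ S
  · have heq : clusterIs b S ∩ (openConn b c : Set (BondConfig V)) = clusterIs b S :=
      Set.inter_eq_left.2 fun ω hω => (twoReplica_mem_openConn_iff hω).2 hc
    rw [heq]
    calc (bondPercolation G p).prod (bondPercolation G p)
          ((openConnIn ((↑S : Set V)ᶜ) o a : Set (BondConfig V)) ×ˢ clusterIs b S)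
        ≤ bondPercolation G p (openConnIn ((↑S : Set V)ᶜ) o a) *
            bondPercolation G p (clusterIs b S) := Measure.prod_prod_le _ _
      _ = bondPercolation G p (clusterIs b S ∩ openConnIn ((↑S : Set V)ᶜ) o a) := by
          rw [mul_comm, measure_clusterIs_inter_offConn]
  · have heq : clusterIs b S ∩ (openConn b c : Set (BondConfig V)) = ∅ :=
      Set.eq_empty_of_forall_notMem fun ω hω => hc ((twoReplica_mem_openConn_iff hω.1).1 hω.2)
    rw [heq, Set.prod_empty, measure_empty]
    exact zero_le

/-- The pieces `{K_b = S} ∩ {b ↔ c} ∩ {o ↔ a off S}` are pairwise disjoint in `S` (they lie in the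
pairwise disjoint events `{K_b = S}`). -/
theorem twoReplica_pieces_disjoint (o a b c : V) :
    Pairwise (Function.onFun Disjoint fun S : Finset V =>
      clusterIs b S ∩ openConn b c ∩ (openConnIn ((↑S : Set V)ᶜ) o a : Set (BondConfig V))) := by
  intro S T hST
  simp only [Function.onFun]
  exact Disjoint.mono (fun ω hω => hω.1.1) (fun ω hω => hω.1.1) (pairwise_disjoint_clusterIs b hST)

/-- Each piece `{K_b = S} ∩ {b ↔ c} ∩ {o ↔ a off S}` is measurable (`V` countable). -/
theorem twoReplica_piece_measurable [Countable V] (o a b c : V) (S : Finset V) :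
    MeasurableSet
      (clusterIs b S ∩ openConn b c ∩ (openConnIn ((↑S : Set V)ᶜ) o a : Set (BondConfig V))) :=
  ((measurableSet_clusterIs b S).inter (measurableSet_openConn_holds b c)).inter
    (measurableSet_offConn S o a)

/-- Each piece lies in the disjoint-coexistence event:
`{K_b = S} ∩ {b ↔ c} ∩ {o ↔ a off S} ⊆ {o ↔ a, b ↔ c, o ↮ b}`, since `{o ↔ a off S} ⊆ {o ↔ a}`
forces `o ∈ Sᶜ = C(b)ᶜ`. -/
theorem twoReplica_piece_subset (o a b c : V) (S : Finset V) :
    clusterIs b S ∩ openConn b c ∩ (openConnIn ((↑S : Set V)ᶜ) o a : Set (BondConfig V)) ⊆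
      openConn o a ∩ openConn b c ∩ (openConn o b)ᶜ := by
  rintro ω ⟨⟨hK, hbc⟩, hoff⟩
  refine ⟨⟨openConnIn_subset_openConn _ o a hoff, hbc⟩, fun h => ?_⟩
  have ho : o ∈ ((↑S : Set V)ᶜ) := by
    obtain ⟨ho, -, -⟩ := hoff
    exact ho
  exact ho ((twoReplica_mem_openConn_iff hK).1 (show ω ∈ openConn b o from
    SimpleGraph.Reachable.symm h))

/-- **The two-replica bound in `[0, ∞]`.**
`(P ⊗ P){a ∈ C₁(o), c ∈ C₂(b), C₂(b) finite, C₁(o) ∩ C₂(b) = ∅} ≤ P(o ↔ a, b ↔ c, o ↮ b)`: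
cover by the exploration pieces, countable subadditivity, the termwise one-configuration bound,
and re-summation of the pairwise disjoint pieces inside the target event. -/
theorem twoReplica_measure_le [Countable V] (G : SimpleGraph V) (p : unitInterval) (o a b c : V) :
    (bondPercolation G p).prod (bondPercolation G p)
        {q | a ∈ openCluster q.1 o ∧ c ∈ openCluster q.2 b ∧ (openCluster q.2 b).Finite ∧
             Disjoint (openCluster q.1 o) (openCluster q.2 b)} ≤
      bondPercolation G p (openConn o a ∩ openConn b c ∩ (openConn o b)ᶜ) :=
  calc (bondPercolation G p).prod (bondPercolation G p)
        {q | a ∈ openCluster q.1 o ∧ c ∈ openCluster q.2 b ∧ (openCluster q.2 b).Finite ∧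
             Disjoint (openCluster q.1 o) (openCluster q.2 b)}
      ≤ (bondPercolation G p).prod (bondPercolation G p)
          (⋃ S : Finset V, (openConnIn ((↑S : Set V)ᶜ) o a : Set (BondConfig V)) ×ˢ
            (clusterIs b S ∩ openConn b c)) := measure_mono (twoReplica_cover o a b c)
    _ ≤ ∑' S : Finset V, (bondPercolation G p).prod (bondPercolation G p)
          ((openConnIn ((↑S : Set V)ᶜ) o a : Set (BondConfig V)) ×ˢ
            (clusterIs b S ∩ openConn b c)) := measure_iUnion_le _
    _ ≤ ∑' S : Finset V, bondPercolation G p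
          (clusterIs b S ∩ openConn b c ∩ openConnIn ((↑S : Set V)ᶜ) o a) :=
        ENNReal.tsum_le_tsum fun S => twoReplica_prod_piece_le G p o a b c S
    _ = bondPercolation G p
          (⋃ S : Finset V, clusterIs b S ∩ openConn b c ∩ openConnIn ((↑S : Set V)ᶜ) o a) :=
        (measure_iUnion (twoReplica_pieces_disjoint o a b c) (twoReplica_piece_measurable o a b c)).symm
    _ ≤ bondPercolation G p (openConn o a ∩ openConn b c ∩ (openConn o b)ᶜ) :=
        measure_mono (Set.iUnion_subset fun S => twoReplica_piece_subset o a b c S)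

/-- **S7 — two-replica (cluster-gas) lower bound.** For `P = bondPercolation G p` on any graph with
countably many vertices and any `p`: two INDEPENDENT configurations with `a ∈ C₁(o)`, `c ∈ C₂(b)`,
`C₂(b)` finite and `C₁(o) ∩ C₂(b) = ∅` are at most as likely as disjoint coexistence
`{o ↔ a, b ↔ c, o ↮ b}` in ONE configuration. Proof: explore `C₂(b) = S`, bound
`{a ∈ C₁(o), C₁(o) ∩ S = ∅}` by `{o ↔ a off S}`, use `(P ⊗ P)(A × B) ≤ P(A) P(B)` and the
one-configuration independence `P(K_b = S) P(o ↔ a off S) = P(K_b = S, o ↔ a off S)` (disjoint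
edge supports), and re-sum the pairwise disjoint events `{K_b = S, o ↔ a off S}`, `S ∋ c`, each of
which lies in `{o ↔ a, b ↔ c, o ↮ b}`. -/
theorem stub_twoReplica {V : Type*} [Countable V] (G : SimpleGraph V) (p : unitInterval) (o a b c : V) :
    ((bondPercolation G p).prod (bondPercolation G p)).real
        {q | a ∈ openCluster q.1 o ∧ c ∈ openCluster q.2 b ∧ (openCluster q.2 b).Finite ∧
             Disjoint (openCluster q.1 o) (openCluster q.2 b)} ≤
      (bondPercolation G p).real (openConn o a ∩ openConn b c ∩ (openConn o b)ᶜ) := by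
  rw [measureReal_def, measureReal_def]
  exact ENNReal.toReal_mono (measure_ne_top _ _) (twoReplica_measure_le G p o a b c)

end Summit.CriticalPhenomena.PercolationContinuityZ3.Theorems.TetrahedronDisjointCoexistence

end
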